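import Mathlib

/-!
# Exponential beats polynomial — stub `stub_expBeatsPoly` of line `Sketch`
(crux `AutomaticPackingThesis`, stmt-MatrixMultiplication-7356)

For a real `r > 1`, a natural exponent `n` and any real constant `c`, some `m : ℕ` satisfies
`c * (m + 1) ^ n < r ^ m`. In the normal form of the crux, the `m`-th concatenation power of a
beating STPP design has packing ratio `r ^ m` while its words fall into at most `(m + 1) ^ n`
size-profile classes; this is the elementary growth comparison the pigeonhole step needs.
Proof: Mathlib's `tendsto_pow_const_div_const_pow_of_one_lt` (`m ^ n / r ^ m → 0`), shifted by
one index (`Filter.tendsto_add_atTop_iff_nat`), gives `(m + 1) ^ n / r ^ (m + 1) → 0`; pick `m`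
with this ratio below `1 / ((|c| + 1) * r)` and cancel one factor `r`.
-/

set_option linter.dupNamespace false
-- (single-conjunct summit: the namespace repeats `MatrixMultiplication`)

namespace Summit.MatrixMultiplication.MatrixMultiplication.Theorems.AutomaticPackingThesis

open Filter Topology

/-- **Exponential beats polynomial** (registered stub `stub_expBeatsPoly` of line `Sketch`):
for `1 < r`, every `n : ℕ` and every real `c` there is `m : ℕ` with `c * (m + 1) ^ n < r ^ m`.
From `(m + 1) ^ n / r ^ (m + 1) → 0` (`tendsto_pow_const_div_const_pow_of_one_lt` shifted by
`tendsto_add_atTop_iff_nat`), choose `m` with the ratio below `1 / ((|c| + 1) * r)`; then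
`c * (m + 1) ^ n ≤ (|c| + 1) * (m + 1) ^ n < r ^ m`. [folklore] -/
theorem stub_expBeatsPoly (r : ℝ) (hr : 1 < r) (n : ℕ) (c : ℝ) :
    ∃ m : ℕ, c * ((m : ℝ) + 1) ^ n < r ^ m := by
  have hr0 : 0 < r := zero_lt_one.trans hr
  -- shifted limit: `(m+1)^n / r^(m+1) → 0`
  have h : Tendsto (fun m : ℕ => ((m + 1 : ℕ) : ℝ) ^ n / r ^ (m + 1)) atTop (𝓝 0) :=
    (tendsto_add_atTop_iff_nat 1).2 (tendsto_pow_const_div_const_pow_of_one_lt n hr)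
  have hε : (0 : ℝ) < 1 / ((|c| + 1) * r) := by positivity
  obtain ⟨m, hm⟩ := (h.eventually (eventually_lt_nhds hε)).exists
  refine ⟨m, ?_⟩
  have hrm : 0 < r ^ (m + 1) := pow_pos hr0 _
  rw [div_lt_div_iff₀ hrm (by positivity), one_mul] at hm
  push_cast at hm
  -- `hm : ((m:ℝ) + 1) ^ n * ((|c| + 1) * r) < r ^ (m + 1)`
  have hpow : 0 ≤ ((m : ℝ) + 1) ^ n := by positivity
  have h2 : ((m : ℝ) + 1) ^ n * (|c| + 1) < r ^ m := by
    have h3 : ((m : ℝ) + 1) ^ n * (|c| + 1) * r < r ^ m * r := by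
      calc ((m : ℝ) + 1) ^ n * (|c| + 1) * r
          = ((m : ℝ) + 1) ^ n * ((|c| + 1) * r) := by ring
        _ < r ^ (m + 1) := hm
        _ = r ^ m * r := pow_succ r m
    exact lt_of_mul_lt_mul_right h3 hr0.le
  calc c * ((m : ℝ) + 1) ^ n
      ≤ |c| * ((m : ℝ) + 1) ^ n := mul_le_mul_of_nonneg_right (le_abs_self c) hpow
    _ ≤ ((m : ℝ) + 1) ^ n * (|c| + 1) := by nlinarith
    _ < r ^ m := h2

end Summit.MatrixMultiplication.MatrixMultiplication.Theorems.AutomaticPackingThesis
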